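import Summits.Ventures.Crystal3D.Bulk.GapFaceWalk
import Summits.Ventures.Crystal3D.Bulk.GapFaceCorners
import Mathlib.Dynamics.PeriodicPts.Defs
import HarnessLib

/-!
# Faces of the two-level tight map as orbits of the face successor; face lengths, the
# partition of the darts into faces, and Euler's formula as an angle identity
# (`phase2/LEAN-FACES-DESIGN.md` (F1))

HONEST FRAMING. Part of the venture `Summits/Ventures/Crystal3D` (cell `pub-crystal3d`, phase 2;
seat typer-bulk-2). `Bulk/GapDarts.lean` / `Bulk/GapFaceWalk.lean` make the face successor
`faceSucc c` (`φ = σ ∘ α`) a permutation of the darts of an admissible configuration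
(`intruderDist² < 3`) all of whose walks close up; `Bulk/GapFaceCorners.lean` attaches to every
dart the corner of its face at its head (`faceCorner`, `= dartGap`, summing to
`2π · #activeVertices`). THIS file makes the FACES first-class objects:

* `faceOf c q` — the face through the dart `q`: the `φ`-orbit `{φ^[n] q}` as a `Finset` of darts;
  `faceLen c q` (its length, Mathlib's `Function.minimalPeriod`), `card_faceOf`, `mem_faceOf_iff`,
  `faceOf_iterate` / `faceOf_eq_of_mem` (a face is the face of each of its darts),
  `IsGapConfig.faceOf_subset_darts`;
* `faces c` (the finset of faces), `numFaces c`; **the faces partition the darts**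
  (`IsGapConfig.pairwiseDisjoint_faces`, `IsGapConfig.biUnion_faces`,
  `IsGapConfig.sum_card_faces : Σ_{F ∈ faces c} #F = 2 · tightCount c`);
* **every face has length `≥ 3`** under the census socket (`CensusRows.three_le_faceLen`: no
  fixed dart, and a `2`-cycle would need a vertex of tight degree `1`);
* `faceAngleSum c F = Σ_{q ∈ F} faceCorner c q` (the sum of the corners of a face),
  `IsGapConfig.sum_faceAngleSum` (`= 2π · #activeVertices`), and **Euler's formula as an angle
  identity** `IsGapConfig.euler_angle_identity`:
  `Σ_{F ∈ faces c} (faceAngleSum c F − (#F − 2)·π) = 2π · (V′ − E + F)` with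
  `V′ = #activeVertices c`, `E = tightCount c`, `F = numFaces c` — so `V′ − E + F = 2` for the
  tight map is EQUIVALENT to "the total angular excess `Σ_F (Σ corners − (#F − 2)π)` of its faces
  is `4π`" (the Gauss–Bonnet form in which DESIGN-L12-THEORY P-L3(b) L1 uses it).

Nothing is claimed about GAP(1.26): planarity `V′ − E + F = 2` itself (F2), faces as REGIONS of
the sphere, Lemma L and the face-size bounds are NOT here.
-/

noncomputable section

open scoped BigOperators
open Finset Function

namespace Summit.Ventures.Crystal3D

variable {c : Fin 14 → EuclideanSpace ℝ (Fin 3)}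

/-! ## The face through a dart -/

/-- Every dart is a periodic point of the face successor (admissible, `D² < 3`). -/
theorem IsGapConfig.mem_periodicPts_faceSucc (hc : IsGapConfig c) (hD3 : intruderDist c ^ 2 < 3)
    {q : Fin 14 × Fin 14} (hq : q ∈ darts c) : q ∈ periodicPts (faceSucc c) := by
  obtain ⟨n, hn0, -, hn⟩ := hc.exists_iterate_faceSucc_eq_self hD3 hq
  exact mk_mem_periodicPts hn0 hn

/-- **The length of the face through the dart `q`**: the least `n > 0` with `φ^[n] q = q`
(Mathlib's `Function.minimalPeriod`; `0` if the walk does not close, which does not happen for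
darts of admissible configurations). -/
def faceLen (c : Fin 14 → EuclideanSpace ℝ (Fin 3)) (q : Fin 14 × Fin 14) : ℕ :=
  minimalPeriod (faceSucc c) q

/-- **The face through the dart `q`**: its orbit `{q, φ q, …, φ^[faceLen − 1] q}` under the face
successor, as a finset of darts (the combinatorial face to the left of `q`). -/
def faceOf (c : Fin 14 → EuclideanSpace ℝ (Fin 3)) (q : Fin 14 × Fin 14) :
    Finset (Fin 14 × Fin 14) :=
  (Finset.range (faceLen c q)).image fun n => (faceSucc c)^[n] q

/-- The walk closes after `faceLen` steps. -/
theorem iterate_faceLen (c : Fin 14 → EuclideanSpace ℝ (Fin 3)) (q : Fin 14 × Fin 14) :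
    (faceSucc c)^[faceLen c q] q = q :=
  iterate_minimalPeriod

/-- The face length of a dart is positive (admissible, `D² < 3`). -/
theorem IsGapConfig.faceLen_pos (hc : IsGapConfig c) (hD3 : intruderDist c ^ 2 < 3)
    {q : Fin 14 × Fin 14} (hq : q ∈ darts c) : 0 < faceLen c q :=
  minimalPeriod_pos_of_mem_periodicPts (hc.mem_periodicPts_faceSucc hD3 hq)

/-- **A face has `faceLen` darts** (the iterates below the minimal period are distinct). -/
theorem card_faceOf (c : Fin 14 → EuclideanSpace ℝ (Fin 3)) (q : Fin 14 × Fin 14) :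
    (faceOf c q).card = faceLen c q := by
  unfold faceOf
  rw [Finset.card_image_of_injOn, Finset.card_range]
  intro m hm n hn hmn
  rw [Finset.coe_range, Set.mem_Iio] at hm hn
  exact iterate_injOn_Iio_minimalPeriod hm hn hmn

/-- Membership in a face: `q' ∈ faceOf c q ↔ q' = φ^[n] q` for some `n` (`q` periodic). -/
theorem mem_faceOf_iff {q q' : Fin 14 × Fin 14} (hq : q ∈ periodicPts (faceSucc c)) :
    q' ∈ faceOf c q ↔ ∃ n, (faceSucc c)^[n] q = q' := by
  unfold faceOf faceLen
  rw [Finset.mem_image]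
  constructor
  · rintro ⟨n, -, hn⟩
    exact ⟨n, hn⟩
  · rintro ⟨n, rfl⟩
    refine ⟨n % minimalPeriod (faceSucc c) q, ?_, iterate_mod_minimalPeriod_eq⟩
    rw [Finset.mem_range]
    exact Nat.mod_lt _ (minimalPeriod_pos_of_mem_periodicPts hq)

/-- A dart lies on its own face. -/
theorem self_mem_faceOf {q : Fin 14 × Fin 14} (hq : q ∈ periodicPts (faceSucc c)) :
    q ∈ faceOf c q :=
  (mem_faceOf_iff hq).2 ⟨0, rfl⟩

/-- Iterates lie on the face. -/
theorem iterate_mem_faceOf {q : Fin 14 × Fin 14} (hq : q ∈ periodicPts (faceSucc c)) (n : ℕ) :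
    (faceSucc c)^[n] q ∈ faceOf c q :=
  (mem_faceOf_iff hq).2 ⟨n, rfl⟩

/-- A face is closed under the face successor. -/
theorem faceSucc_mem_faceOf {q q' : Fin 14 × Fin 14} (hq : q ∈ periodicPts (faceSucc c))
    (hq' : q' ∈ faceOf c q) : faceSucc c q' ∈ faceOf c q := by
  obtain ⟨n, rfl⟩ := (mem_faceOf_iff hq).1 hq'
  have he : faceSucc c ((faceSucc c)^[n] q) = (faceSucc c)^[n + 1] q :=
    (Function.iterate_succ_apply' (faceSucc c) n q).symm
  rw [he]
  exact iterate_mem_faceOf hq (n + 1)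

/-- **The face through an iterate is the same face.** -/
theorem faceOf_iterate {q : Fin 14 × Fin 14} (hq : q ∈ periodicPts (faceSucc c)) (n : ℕ) :
    faceOf c ((faceSucc c)^[n] q) = faceOf c q := by
  have hq' : (faceSucc c)^[n] q ∈ periodicPts (faceSucc c) := by
    obtain ⟨p, hp, hper⟩ := hq
    exact ⟨p, hp, hper.apply_iterate n⟩
  ext x
  rw [mem_faceOf_iff hq', mem_faceOf_iff hq]
  constructor
  · rintro ⟨m, rfl⟩
    exact ⟨m + n, by rw [Function.iterate_add_apply]⟩
  · rintro ⟨m, rfl⟩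
    -- go around: `φ^[m] q = φ^[m + (p - n % p)] (φ^[n] q)` with `p` the period
    set p := minimalPeriod (faceSucc c) q with hp
    have hppos : 0 < p := minimalPeriod_pos_of_mem_periodicPts hq
    refine ⟨m + (p - n % p), ?_⟩
    have hle : n % p ≤ p := (Nat.mod_lt _ hppos).le
    calc (faceSucc c)^[m + (p - n % p)] ((faceSucc c)^[n] q)
        = (faceSucc c)^[m + (p - n % p)] ((faceSucc c)^[n % p] q) := by
          rw [iterate_mod_minimalPeriod_eq]
      _ = (faceSucc c)^[m + p] q := by
          rw [← Function.iterate_add_apply]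
          congr 1
          omega
      _ = (faceSucc c)^[m] q := by
          rw [Function.iterate_add_apply, hp, iterate_minimalPeriod]

/-- **A face is the face of each of its darts.** -/
theorem faceOf_eq_of_mem {q q' : Fin 14 × Fin 14} (hq : q ∈ periodicPts (faceSucc c))
    (hq' : q' ∈ faceOf c q) : faceOf c q' = faceOf c q := by
  obtain ⟨n, rfl⟩ := (mem_faceOf_iff hq).1 hq'
  exact faceOf_iterate hq n

/-- Darts on a common face have the same face length. -/
theorem faceLen_eq_of_mem {q q' : Fin 14 × Fin 14} (hq : q ∈ periodicPts (faceSucc c))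
    (hq' : q' ∈ faceOf c q) : faceLen c q' = faceLen c q := by
  rw [← card_faceOf, ← card_faceOf, faceOf_eq_of_mem hq hq']

/-- A face consists of darts (admissible, `D² < 3`). -/
theorem IsGapConfig.faceOf_subset_darts (hc : IsGapConfig c) (hD3 : intruderDist c ^ 2 < 3)
    {q : Fin 14 × Fin 14} (hq : q ∈ darts c) : faceOf c q ⊆ darts c := by
  intro q' hq'
  obtain ⟨n, rfl⟩ := (mem_faceOf_iff (hc.mem_periodicPts_faceSucc hD3 hq)).1 hq'
  exact hc.iterate_faceSucc_mem_darts hD3 hq n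

/-! ## The set of faces; the faces partition the darts -/

/-- **The faces of the tight map**: the distinct `φ`-orbits of the darts. -/
def faces (c : Fin 14 → EuclideanSpace ℝ (Fin 3)) : Finset (Finset (Fin 14 × Fin 14)) :=
  (darts c).image (faceOf c)

/-- **The number of faces** of the tight map. -/
def numFaces (c : Fin 14 → EuclideanSpace ℝ (Fin 3)) : ℕ :=
  (faces c).card

/-- Membership in `faces`. -/
theorem mem_faces_iff {F : Finset (Fin 14 × Fin 14)} :
    F ∈ faces c ↔ ∃ q ∈ darts c, faceOf c q = F := by
  unfold faces
  rw [Finset.mem_image]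

/-- The face of a dart is a face. -/
theorem faceOf_mem_faces {q : Fin 14 × Fin 14} (hq : q ∈ darts c) : faceOf c q ∈ faces c :=
  mem_faces_iff.2 ⟨q, hq, rfl⟩

/-- Every face is nonempty (admissible, `D² < 3`). -/
theorem IsGapConfig.nonempty_of_mem_faces (hc : IsGapConfig c) (hD3 : intruderDist c ^ 2 < 3)
    {F : Finset (Fin 14 × Fin 14)} (hF : F ∈ faces c) : F.Nonempty := by
  obtain ⟨q, hq, rfl⟩ := mem_faces_iff.1 hF
  exact ⟨q, self_mem_faceOf (hc.mem_periodicPts_faceSucc hD3 hq)⟩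

/-- Every face consists of darts (admissible, `D² < 3`). -/
theorem IsGapConfig.subset_darts_of_mem_faces (hc : IsGapConfig c) (hD3 : intruderDist c ^ 2 < 3)
    {F : Finset (Fin 14 × Fin 14)} (hF : F ∈ faces c) : F ⊆ darts c := by
  obtain ⟨q, hq, rfl⟩ := mem_faces_iff.1 hF
  exact hc.faceOf_subset_darts hD3 hq

/-- A face is the face of each of its darts (admissible, `D² < 3`). -/
theorem IsGapConfig.faceOf_eq_of_mem_faces (hc : IsGapConfig c) (hD3 : intruderDist c ^ 2 < 3)
    {F : Finset (Fin 14 × Fin 14)} (hF : F ∈ faces c) {q : Fin 14 × Fin 14} (hq : q ∈ F) :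
    faceOf c q = F := by
  obtain ⟨q₀, hq₀, rfl⟩ := mem_faces_iff.1 hF
  exact faceOf_eq_of_mem (hc.mem_periodicPts_faceSucc hD3 hq₀) hq

/-- **Distinct faces are disjoint** (admissible, `D² < 3`). -/
theorem IsGapConfig.pairwiseDisjoint_faces (hc : IsGapConfig c) (hD3 : intruderDist c ^ 2 < 3) :
    (faces c : Set (Finset (Fin 14 × Fin 14))).PairwiseDisjoint id := by
  intro F hF F' hF' hne
  rw [Finset.mem_coe] at hF hF'
  rw [Function.onFun, id, id, Finset.disjoint_left]
  intro q hq hq'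
  exact hne ((hc.faceOf_eq_of_mem_faces hD3 hF hq).symm.trans (hc.faceOf_eq_of_mem_faces hD3 hF' hq'))

/-- **The faces cover the darts** (admissible, `D² < 3`). -/
theorem IsGapConfig.biUnion_faces (hc : IsGapConfig c) (hD3 : intruderDist c ^ 2 < 3) :
    (faces c).biUnion id = darts c := by
  ext q
  rw [Finset.mem_biUnion]
  constructor
  · rintro ⟨F, hF, hq⟩
    exact hc.subset_darts_of_mem_faces hD3 hF hq
  · intro hq
    exact ⟨faceOf c q, faceOf_mem_faces hq, self_mem_faceOf (hc.mem_periodicPts_faceSucc hD3 hq)⟩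

/-- Summing over the darts face by face (admissible, `D² < 3`). -/
theorem IsGapConfig.sum_faces_sum (hc : IsGapConfig c) (hD3 : intruderDist c ^ 2 < 3)
    (f : Fin 14 × Fin 14 → ℝ) : ∑ F ∈ faces c, ∑ q ∈ F, f q = ∑ q ∈ darts c, f q := by
  rw [← hc.biUnion_faces hD3, Finset.sum_biUnion (hc.pairwiseDisjoint_faces hD3)]
  rfl

/-- **The faces partition the darts: `Σ_{F ∈ faces c} #F = #darts c = 2 · tightCount c`**
(admissible, `D² < 3`). -/
theorem IsGapConfig.sum_card_faces (hc : IsGapConfig c) (hD3 : intruderDist c ^ 2 < 3) :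
    ∑ F ∈ faces c, F.card = 2 * tightCount c := by
  rw [← card_darts c, ← hc.biUnion_faces hD3, Finset.card_biUnion (hc.pairwiseDisjoint_faces hD3)]
  rfl

/-! ## Every face has at least three darts (under the census socket) -/

/-- The face successor moves every dart (the head becomes the tail). -/
theorem faceSucc_ne_self {q : Fin 14 × Fin 14} (hq : q ∈ darts c) : faceSucc c q ≠ q := by
  intro h
  have h1 : (faceSucc c q).1 = q.1 := by rw [h]
  simp only [faceSucc] at h1
  exact (mem_darts.1 hq).2.2.1 h1.symm

/-- Under the socket hypothesis no face walk closes after two steps: `φ (φ q) ≠ q` (a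
`2`-cycle through `q = (i, j)` would force `nextNbr c j i = i`, i.e. tight degree `1` at `j`). -/
theorem CensusRows.faceSucc_faceSucc_ne_self (h : CensusRows c) {q : Fin 14 × Fin 14}
    (hq : q ∈ darts c) : faceSucc c (faceSucc c q) ≠ q := by
  intro h2
  have h1 : (faceSucc c (faceSucc c q)).1 = q.1 := by rw [h2]
  simp only [faceSucc] at h1
  -- `h1 : nextNbr c q.2 q.1 = q.1`
  have hj0 : q.2 ≠ 0 := (mem_darts.1 hq).2.1
  have hi : q.1 ∈ tightNbrs c q.2 := by
    have := snd_mem_tightNbrs_of_mem_darts (swap_mem_darts hq)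
    simpa only [Prod.fst_swap, Prod.snd_swap] using this
  exact h.nextNbr_ne_self hj0 hi h1

/-- **Every face has at least three darts** under the socket hypothesis. -/
theorem CensusRows.three_le_faceLen (h : CensusRows c) {q : Fin 14 × Fin 14} (hq : q ∈ darts c) :
    3 ≤ faceLen c q := by
  obtain ⟨hD3, -, -⟩ := h.intruderDist_bounds
  have hpos := h.isGapConfig.faceLen_pos hD3 hq
  have hfix := iterate_faceLen c q
  have h1 : faceLen c q ≠ 1 := fun h1 => by
    rw [h1] at hfix
    exact faceSucc_ne_self hq hfix
  have h2 : faceLen c q ≠ 2 := fun h2 => by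
    rw [h2] at hfix
    exact h.faceSucc_faceSucc_ne_self hq hfix
  omega

/-- Under the socket hypothesis every face has at least three darts. -/
theorem CensusRows.three_le_card_of_mem_faces (h : CensusRows c) {F : Finset (Fin 14 × Fin 14)}
    (hF : F ∈ faces c) : 3 ≤ F.card := by
  obtain ⟨q, hq, rfl⟩ := mem_faces_iff.1 hF
  rw [card_faceOf]
  exact h.three_le_faceLen hq

/-- Hence under the socket hypothesis `3 · numFaces c ≤ 2 · tightCount c`. -/
theorem CensusRows.three_mul_numFaces_le (h : CensusRows c) :
    3 * numFaces c ≤ 2 * tightCount c := by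
  obtain ⟨hD3, -, -⟩ := h.intruderDist_bounds
  rw [← h.isGapConfig.sum_card_faces hD3, numFaces, Finset.card_eq_sum_ones, Finset.mul_sum]
  exact Finset.sum_le_sum fun F hF => by simpa using h.three_le_card_of_mem_faces hF

/-! ## Corner sums of faces; Euler's formula as an angle identity -/

/-- **The sum of the corners of a face** (its corner at the head of each of its darts). -/
def faceAngleSum (c : Fin 14 → EuclideanSpace ℝ (Fin 3)) (F : Finset (Fin 14 × Fin 14)) : ℝ :=
  ∑ q ∈ F, faceCorner c q

/-- **Summing the corner sums over the faces gives `2π · #activeVertices c`** (admissible,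
`D² < 3`): the faces partition the darts and the darts at each active vertex carry its gaps
(`IsGapConfig.sum_faceCorner`). -/
theorem IsGapConfig.sum_faceAngleSum (hc : IsGapConfig c) (hD3 : intruderDist c ^ 2 < 3) :
    ∑ F ∈ faces c, faceAngleSum c F = 2 * Real.pi * (activeVertices c).card := by
  unfold faceAngleSum
  rw [hc.sum_faces_sum hD3, hc.sum_faceCorner hD3]

/-- **Euler's formula for the tight map as an angle identity.** For an admissible configuration
with `intruderDist² < 3`:
`Σ_{F ∈ faces c} (faceAngleSum c F − (#F − 2)·π) = 2π · (#activeVertices c − tightCount c + numFaces c)`.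
The left side is the total ANGULAR EXCESS of the faces (for a face bounding a disc with those
corners, its area by Gauss–Bonnet); so `V′ − E + F = 2` for the tight map (`V′` = active vertices,
`E` = tight pairs, `F` = faces) is equivalent to "total excess `= 4π`" (the area of the sphere). -/
theorem IsGapConfig.euler_angle_identity (hc : IsGapConfig c) (hD3 : intruderDist c ^ 2 < 3) :
    ∑ F ∈ faces c, (faceAngleSum c F - ((F.card : ℝ) - 2) * Real.pi) =
      2 * Real.pi * ((activeVertices c).card - (tightCount c : ℝ) + numFaces c) := by
  have hcard : ∑ F ∈ faces c, (F.card : ℝ) = 2 * tightCount c := by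
    rw [← Nat.cast_sum, hc.sum_card_faces hD3]
    push_cast
    ring
  have h1 : ∑ F ∈ faces c, (faceAngleSum c F - ((F.card : ℝ) - 2) * Real.pi) =
      ∑ F ∈ faces c, faceAngleSum c F - (∑ F ∈ faces c, ((F.card : ℝ) - 2)) * Real.pi := by
    rw [Finset.sum_sub_distrib, Finset.sum_mul]
  rw [h1, hc.sum_faceAngleSum hD3, Finset.sum_sub_distrib, hcard, Finset.sum_const, nsmul_eq_mul,
    numFaces]
  ring

/-- **Euler ⟺ total excess `4π`** (admissible, `D² < 3`): the tight map satisfies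
`#activeVertices − tightCount + numFaces = 2` iff the total angular excess of its faces is `4π`. -/
theorem IsGapConfig.euler_iff_excess (hc : IsGapConfig c) (hD3 : intruderDist c ^ 2 < 3) :
    ((activeVertices c).card : ℝ) - tightCount c + numFaces c = 2 ↔
      ∑ F ∈ faces c, (faceAngleSum c F - ((F.card : ℝ) - 2) * Real.pi) = 4 * Real.pi := by
  rw [hc.euler_angle_identity hD3]
  constructor
  · intro h
    rw [h]
    ring
  · intro h
    have hpi : Real.pi ≠ 0 := Real.pi_pos.ne'
    have : 2 * Real.pi * ((activeVertices c).card - (tightCount c : ℝ) + numFaces c - 2) = 0 := by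
      linarith
    rcases mul_eq_zero.1 this with h0 | h0
    · exact absurd h0 (mul_ne_zero two_ne_zero hpi)
    · linarith

end Summit.Ventures.Crystal3D
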